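import Literature.Probability.RandomPlanarGeometry.HexSAWKestenRenewal
import Literature.Probability.Process.RenewalTheorem
import Mathlib.Algebra.Order.Chebyshev
import Mathlib.Order.Monotone.Monovary
import Mathlib.NumberTheory.Harmonic.Bounds
import HarnessLib

/-!
# The width law of Kesten's irreducible-bridge renewal on the hexagonal lattice at `x_c`:
# an explicit tail bound and an explicit truncated-mean bound

Topic `Literature/Probability/RandomPlanarGeometry` (continues `HexSAWKestenRenewal.lean`: the critical weights
`I_T = I_T(x_c)` of the irreducible bridges of width `T` of Duminil-Copin–Smirnov's strips form a probability
distribution, `Σ_{T ≥ 1} I_T = 1` (`HV.hasSum_stripIlim`), with renewal equation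
`B_{m+1} = Σ_{k<m} I_{k+1} B_{m-k} + I_{m+1}` (`HV.renewal_equation_range`); `HexSAWStripIdentity.lean`:
`B_T` is non-increasing (`HV.stripBlim_antitone'`, Krachun–Panagiotis Lemma 2.3) and obeys Duminil-Copin–Smirnov's
harmonic lower bound `B_{T+1} ≥ m/(T+1)`, `m = min(B_1, (c_α x_c⁻¹)⁻¹) > 0` (`HV.stripBlim_ge_div`,
`HV.stripBlim_ge_div_pos`; the print has `min[B_1, 1/(c_α x_c)]` — immaterial, the minimum is `B_1` either way);
`Literature/Probability/Process/RenewalTheorem.lean`: the conservation law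
`Σ_{k ≤ n} r_k u_{n-k} = 1` of a recurrent renewal sequence (Madras–Slade (B.5))).

Sources.  H. Kesten, *On the number of self-avoiding walks*, J. Math. Phys. 4 (1963), §4 (the irreducible-bridge
renewal; Madras–Slade, *The Self-Avoiding Walk* (1993), §4.2 and Appendix B, eq. (B.5)); H. Duminil-Copin,
S. Smirnov, Ann. of Math. 175 (2012), §3 (the strip identity, "`B_T ≥ min[B_1, 1/(c_α x_c)]/T`" and
`Σ_T B_T(x_c) = ∞`); W. Feller, *An Introduction to Probability Theory and its Applications* I (1968), XIII.3.
The two displayed inequalities below are the lane's explicit bookkeeping of these printed ingredients (they are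
not stated in this form in the sources): with `r_T := 1 − Σ_{t ≤ T} I_t = P(width > T)` (the tail of the width
law of Kesten's irreducible-bridge measure at `x_c`), `U_T := Σ_{t ≤ T} B_t` and `H_T := Σ_{t ≤ T} 1/t`,

* (a) **tail**: `r_T (1 + U_T) ≤ 1`, hence `P(width > T) ≤ 1/(1 + m H_T) ≤ 1/(1 + m log (T+1))` — from the
  conservation law and the monotonicity of `r`;
* (b) **truncated mean**: `E[min(width, T+1)] = Σ_{j ≤ T} r_j ≥ (T+1)/(1 + U_T)` — from the conservation law and
  CHEBYSHEV's sum inequality for the oppositely monotone sequences `u_n = B_n` (non-increasing) and `r_{T-n}`.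

## Contents (namespace `Literature.Probability.RandomPlanarGeometry.SAW.HV`; everything PROVED, no named facts left open)

* `dcsM` (`m`), `irrTail` (`r_T`), `bridgeMass` (`U_T`), `harm` (`H_T`); `dcsM_pos`, `irrTail_antitone`,
  `irrTail_nonneg`, `irrTail_eq_tsum` (`r_T = Σ_{t > T} I_t`), `tendsto_irrTail`;
* `sum_bridge_mul_irrTail_eq_one` — the last-renewal identity `Σ_{n ≤ N} u_n r_{N-n} = 1` (`u_0 = 1`, `u_n = B_n`);
* `irrTail_mul_one_add_bridgeMass_le_one` — (a) in product form; `dcsM_mul_harm_le_bridgeMass` — `m H_T ≤ U_T`;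
* `succ_le_one_add_bridgeMass_mul_sum_irrTail` — (b) in product form (Chebyshev);
* `HexIrrTailBound`, `HexIrrMeanBound` (the two statements, as `Prop`s for downstream use) with
  **`HexIrrTailBound_holds`**, **`HexIrrMeanBound_holds`**; `irrTail_le_inv_log` — the logarithmic form of (a).
-/

noncomputable section

open Finset Filter Topology

namespace Literature.Probability.RandomPlanarGeometry.SAW

namespace HV

/-! ### The objects -/

/-- Duminil-Copin–Smirnov's harmonic constant `m := min(B_1, (c_α · x_c⁻¹)⁻¹)` of the lower bound `B_{T} ≥ m/T`
(`stripBlim_ge_div`). [cite: DuminilCopinSmirnov2012, §3 (proof of Theorem 1)] -/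
def dcsM : ℝ := min (stripBlim 1) (Real.cos (3 * Real.pi / 8) * hexCriticalFugacity⁻¹)⁻¹

/-- `m > 0` (`B_1 ≥ x_c² > 0`). [cite: DuminilCopinSmirnov2012, §3] -/
theorem dcsM_pos : 0 < dcsM := stripBlim_ge_div_pos

/-- The tail of the width law of Kesten's irreducible-bridge measure at `x_c`:
`r_T := 1 − Σ_{1 ≤ t ≤ T} I_t(x_c)` (`= Σ_{t > T} I_t = P(width > T)` by `hasSum_stripIlim`; `r_0 = 1`).
[cite: Kesten1963SAW, §4; MadrasSlade1993, Appendix B (the tail sums `r_n`)] -/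
def irrTail (T : ℕ) : ℝ := 1 - ∑ t ∈ Icc 1 T, stripIlim t

/-- The bridge mass up to width `T`: `U_T := Σ_{1 ≤ t ≤ T} B_t(x_c)`. [cite: DuminilCopinSmirnov2012, §3] -/
def bridgeMass (T : ℕ) : ℝ := ∑ t ∈ Icc 1 T, stripBlim t

/-- The harmonic number `H_T = Σ_{1 ≤ t ≤ T} 1/t` (as a real number; the partial sums of the divergent series in
Duminil-Copin–Smirnov's "`Σ_T B_T ≥ Σ_T m/T = ∞`"). [cite: DuminilCopinSmirnov2012, §3 (proof of Theorem 1)] -/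
def harm (T : ℕ) : ℝ := ∑ t ∈ Icc 1 T, (1 : ℝ) / t

/-! ### The renewal data in Feller's indexing (`u_0 = 1`, `u_n = B_n`; `f_0 = 0`, `f_t = I_t`) -/

/-- `u_n`: `u_0 = 1`, `u_n = B_n(x_c)` for `n ≥ 1` (plumbing). [folklore] -/
private def rU (n : ℕ) : ℝ := if n = 0 then 1 else stripBlim n

/-- `f_t`: `f_0 = 0`, `f_t = I_t(x_c)` for `t ≥ 1` (plumbing). [folklore] -/
private def rF (t : ℕ) : ℝ := if t = 0 then 0 else stripIlim t

/-- `u_0 = 1`. [folklore] -/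
private theorem rU_zero : rU 0 = 1 := if_pos rfl

/-- `u_n = B_n` for `n ≠ 0`. [folklore] -/
private theorem rU_of_ne {n : ℕ} (hn : n ≠ 0) : rU n = stripBlim n := if_neg hn

/-- `f_0 = 0`. [folklore] -/
private theorem rF_zero : rF 0 = 0 := if_pos rfl

/-- `f_t = I_t` for `t ≠ 0`. [folklore] -/
private theorem rF_of_ne {t : ℕ} (ht : t ≠ 0) : rF t = stripIlim t := if_neg ht

/-- `0 ≤ u_n`. [folklore] -/
private theorem rU_nonneg (n : ℕ) : 0 ≤ rU n := by
  rcases Nat.eq_zero_or_pos n with rfl | hn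
  · rw [rU_zero]; norm_num
  · rw [rU_of_ne hn.ne']; exact stripBlim_nonneg hn

/-- `B_n(x_c) ≤ 1` (Duminil-Copin–Smirnov Lemma 2 in the limit). [cite: DuminilCopinSmirnov2012, Lemma 2 and §3] -/
private theorem bridge_le_one {n : ℕ} (hn : 1 ≤ n) : stripBlim n ≤ 1 :=
  ciSup_le fun L => stripB_le_one_of_lemma2 DuminilCopinSmirnov2012_lemma2_holds hn L

/-- `0 ≤ f_t`. [folklore] -/
private theorem rF_nonneg (t : ℕ) : 0 ≤ rF t := by
  rcases Nat.eq_zero_or_pos t with rfl | ht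
  · rw [rF_zero]
  · rw [rF_of_ne ht.ne']; exact stripIlim_nonneg ht

/-- The renewal equation in Feller's indexing: `u_n = Σ_{k ≤ n} f_k u_{n-k}` (`n ≥ 1`). [cite: Kesten1963SAW, §4; MadrasSlade1993, eq. (4.2.2)] -/
private theorem rU_renewal (n : ℕ) (hn : 1 ≤ n) : rU n = ∑ k ∈ range (n + 1), rF k * rU (n - k) := by
  obtain ⟨m, rfl⟩ : ∃ m, n = m + 1 := ⟨n - 1, by omega⟩
  rw [rU_of_ne (Nat.succ_ne_zero m), renewal_equation_range m, sum_range_succ', rF_zero, zero_mul, add_zero,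
    sum_range_succ]
  have hlast : rF (m + 1) * rU (m + 1 - (m + 1)) = stripIlim (m + 1) := by
    rw [Nat.sub_self, rU_zero, mul_one]; exact rF_of_ne (Nat.succ_ne_zero m)
  rw [hlast, add_left_inj]
  refine sum_congr rfl fun k hk => ?_
  rw [mem_range] at hk
  have hmk : m + 1 - (k + 1) = m - k := by omega
  rw [rF_of_ne (Nat.succ_ne_zero k), hmk, rU_of_ne (by omega)]

/-- `Σ_t f_t = 1` (Kesten's identity `hasSum_stripIlim`, reindexed). [cite: Kesten1963SAW, §4 (Thm. 5)] -/
private theorem hasSum_rF : HasSum rF 1 := by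
  have h : HasSum (fun n => rF (n + 1)) (1 - ∑ i ∈ range 1, rF i) := by
    have h1 : (fun n => rF (n + 1)) = fun n => stripIlim (n + 1) := funext fun n => rF_of_ne (Nat.succ_ne_zero n)
    rw [h1, sum_range_one, rF_zero, sub_zero]
    exact hasSum_stripIlim
  exact (hasSum_nat_add_iff' 1).1 h

/-- `Σ_{1 ≤ t ≤ n} g t = Σ_{k < n} g (k+1)` (reindexing). [folklore] -/
private theorem sum_Icc_eq_sum_range (g : ℕ → ℝ) (n : ℕ) :
    ∑ t ∈ Icc 1 n, g t = ∑ k ∈ range n, g (k + 1) := by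
  induction n with
  | zero => simp
  | succ n ih => rw [sum_range_succ, ← ih, Finset.sum_Icc_succ_top (by omega : 1 ≤ n + 1)]

/-- `r_n = 1 − Σ_{k ≤ n} f_k` (the tail sums of Madras–Slade (B.5)). [cite: MadrasSlade1993, Appendix B] -/
private theorem irrTail_eq_rF (n : ℕ) : irrTail n = 1 - ∑ k ∈ range (n + 1), rF k := by
  have e : (fun k : ℕ => rF (k + 1)) = fun k => stripIlim (k + 1) := funext fun k => rF_of_ne (Nat.succ_ne_zero k)
  have h : ∑ k ∈ range (n + 1), rF k = ∑ t ∈ Icc 1 n, stripIlim t := by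
    rw [sum_range_succ', rF_zero, add_zero, sum_Icc_eq_sum_range, e]
  rw [h, irrTail]

/-- `Σ_{n ≤ T} u_n = 1 + U_T` (reindexing). [folklore] -/
private theorem sum_rU_eq (T : ℕ) : ∑ n ∈ range (T + 1), rU n = 1 + bridgeMass T := by
  have e : (fun k : ℕ => rU (k + 1)) = fun k => stripBlim (k + 1) := funext fun k => rU_of_ne (Nat.succ_ne_zero k)
  rw [sum_range_succ', rU_zero, add_comm, bridgeMass, sum_Icc_eq_sum_range, e]

/-! ### Elementary properties of the tail `r_T` -/

/-- `r_{T+1} = r_T − I_{T+1} ≤ r_T`: the tail is non-increasing. [cite: MadrasSlade1993, Appendix B] -/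
theorem irrTail_succ_le (T : ℕ) : irrTail (T + 1) ≤ irrTail T := by
  rw [irrTail_eq_rF, irrTail_eq_rF, sum_range_succ _ (T + 1)]
  linarith [rF_nonneg (T + 1)]

/-- The tail `T ↦ r_T` is antitone. [cite: MadrasSlade1993, Appendix B] -/
theorem irrTail_antitone : Antitone irrTail := antitone_nat_of_succ_le irrTail_succ_le

/-- `r_0 = 1`. [cite: MadrasSlade1993, Appendix B] -/
theorem irrTail_zero : irrTail 0 = 1 := by simp [irrTail]

/-- `r_T = Σ_{t ≥ 0} I_{t+T+1} = P(width > T)` (Kesten's identity `Σ I_t = 1`). [cite: Kesten1963SAW, §4] -/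
theorem irrTail_eq_tsum (T : ℕ) : irrTail T = ∑' t : ℕ, stripIlim (t + (T + 1)) := by
  rw [Literature.Probability.Process.Renewal.tailSum_eq_tsum (r := irrTail) (f := rF) irrTail_eq_rF hasSum_rF T]
  exact tsum_congr fun _ => rF_of_ne (by omega)

/-- `0 ≤ r_T`. [cite: Kesten1963SAW, §4] -/
theorem irrTail_nonneg (T : ℕ) : 0 ≤ irrTail T :=
  Literature.Probability.Process.Renewal.tailSum_nonneg (r := irrTail) irrTail_eq_rF rF_nonneg hasSum_rF T

/-- `r_T ≤ 1`. [cite: Kesten1963SAW, §4] -/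
theorem irrTail_le_one (T : ℕ) : irrTail T ≤ 1 := by
  simpa [irrTail_zero] using irrTail_antitone (Nat.zero_le T)

/-- `r_T → 0`: the width of a critical irreducible bridge is almost surely finite (recurrence).
[cite: Kesten1963SAW, §4] -/
theorem tendsto_irrTail : Tendsto irrTail atTop (𝓝 0) :=
  Literature.Probability.Process.Renewal.tendsto_tailSum (r := irrTail) irrTail_eq_rF hasSum_rF

/-- `0 ≤ U_T`. [cite: DuminilCopinSmirnov2012, §3] -/
theorem bridgeMass_nonneg (T : ℕ) : 0 ≤ bridgeMass T :=
  sum_nonneg fun _ ht => stripBlim_nonneg (mem_Icc.1 ht).1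

/-! ### The last-renewal identity -/

/-- **The last-renewal identity** of the (recurrent) critical bridge renewal on the hexagonal lattice:
`Σ_{n=0}^{N} u_n · r_{N−n} = 1` with `u_0 = 1`, `u_n = B_n(x_c)`, `r_k = 1 − Σ_{t ≤ k} I_t(x_c)` — decompose a
bridge configuration of width `N` according to its last renewal width (Madras–Slade (B.5); Feller XIII.3).
[cite: MadrasSlade1993, Appendix B, eq. (B.5); Kesten1963SAW, §4] -/
theorem sum_bridge_mul_irrTail_eq_one (N : ℕ) :
    ∑ n ∈ range (N + 1), (if n = 0 then (1 : ℝ) else stripBlim n) * irrTail (N - n) = 1 := by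
  have h := Literature.Probability.Process.Renewal.sum_tailSum_mul_eq_one (r := irrTail) (u := rU) (f := rF)
    irrTail_eq_rF rU_zero rF_zero rU_renewal N
  -- reflect the summation index `k ↦ N - k`
  rw [← sum_range_reflect] at h
  refine Eq.trans (sum_congr rfl fun n hn => ?_) h
  rw [mem_range] at hn
  have h1 : N + 1 - 1 - n = N - n := by omega
  have h2 : N - (N - n) = n := by omega
  rw [h1, h2, mul_comm]
  rfl

/-- The same identity with `u = rU`. [cite: MadrasSlade1993, Appendix B, eq. (B.5)] -/
private theorem sum_rU_mul_irrTail_eq_one (N : ℕ) : ∑ n ∈ range (N + 1), rU n * irrTail (N - n) = 1 :=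
  sum_bridge_mul_irrTail_eq_one N

/-! ### (a) The tail bound -/

/-- **(a), product form: `r_T · (1 + U_T) ≤ 1`** — in the last-renewal identity bound `r_{T−n} ≥ r_T`.
[cite: MadrasSlade1993, Appendix B, eq. (B.5); DuminilCopinSmirnov2012, §3] -/
theorem irrTail_mul_one_add_bridgeMass_le_one (T : ℕ) : irrTail T * (1 + bridgeMass T) ≤ 1 := by
  rw [← sum_rU_eq, mul_sum, ← sum_rU_mul_irrTail_eq_one T]
  refine sum_le_sum fun n hn => ?_
  rw [mul_comm]
  exact mul_le_mul_of_nonneg_left (irrTail_antitone (Nat.sub_le T n)) (rU_nonneg n)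

/-- **`m · H_T ≤ U_T`**: Duminil-Copin–Smirnov's harmonic lower bound `B_t ≥ m/t`, summed over `1 ≤ t ≤ T`.
[cite: DuminilCopinSmirnov2012, §3 (proof of Theorem 1, "B_T ≥ min[B_1, 1/(c_α x_c)]/T")] -/
theorem dcsM_mul_harm_le_bridgeMass (T : ℕ) : dcsM * harm T ≤ bridgeMass T := by
  rw [harm, bridgeMass, mul_sum]
  refine sum_le_sum fun t ht => ?_
  obtain ⟨s, rfl⟩ : ∃ s, t = s + 1 := ⟨t - 1, by have := (mem_Icc.1 ht).1; omega⟩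
  have h := stripBlim_ge_div s
  rw [mul_one_div]
  push_cast
  exact h

/-- **(a) The explicit tail of the critical irreducible-bridge width law on the hexagonal lattice**:
`P(width > T) = r_T ≤ 1/(1 + m · H_T)` for every `T ≥ 1`, `m = min(B_1(x_c), (c_α x_c⁻¹)⁻¹) > 0`,
`H_T` the harmonic number (the lane's explicit form; ingredients: Kesten's renewal, the conservation law (B.5),
Duminil-Copin–Smirnov's `B_T ≥ m/T`). [cite: DuminilCopinSmirnov2012, §3; Kesten1963SAW, §4; MadrasSlade1993, Appendix B, eq. (B.5)] -/
def HexIrrTailBound : Prop := ∀ T : ℕ, 1 ≤ T → irrTail T ≤ 1 / (1 + dcsM * harm T)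

/-- **(a) holds.** [cite: DuminilCopinSmirnov2012, §3; Kesten1963SAW, §4; MadrasSlade1993, Appendix B, eq. (B.5)] -/
theorem HexIrrTailBound_holds : HexIrrTailBound := by
  intro T _
  have hH : 0 ≤ harm T := sum_nonneg fun t _ => by positivity
  have hpos : 0 < 1 + dcsM * harm T := by have := dcsM_pos; positivity
  have hU : 1 + dcsM * harm T ≤ 1 + bridgeMass T := by linarith [dcsM_mul_harm_le_bridgeMass T]
  have hUpos : 0 < 1 + bridgeMass T := lt_of_lt_of_le hpos hU
  have h1 : irrTail T ≤ 1 / (1 + bridgeMass T) := (le_div_iff₀ hUpos).2 (irrTail_mul_one_add_bridgeMass_le_one T)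
  exact h1.trans (one_div_le_one_div_of_le hpos hU)

/-- `H_T ≥ log (T+1)` (integral comparison; Mathlib `log_add_one_le_harmonic`). [cite: DuminilCopinSmirnov2012, §3] -/
theorem log_succ_le_harm (T : ℕ) : Real.log ((T : ℝ) + 1) ≤ harm T := by
  have h := log_add_one_le_harmonic T
  rw [harmonic_eq_sum_Icc] at h
  push_cast at h
  rw [harm]
  convert h using 2 with t
  rw [one_div]

/-- **(a), logarithmic form**: `P(width > T) ≤ 1/(1 + m · log (T+1))` for every `T ≥ 1`.
[cite: DuminilCopinSmirnov2012, §3; Kesten1963SAW, §4] -/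
theorem irrTail_le_inv_log (T : ℕ) (hT : 1 ≤ T) : irrTail T ≤ 1 / (1 + dcsM * Real.log ((T : ℝ) + 1)) := by
  have hm := dcsM_pos
  have hlog : 0 ≤ Real.log ((T : ℝ) + 1) := Real.log_nonneg (by norm_cast; omega)
  have hpos : 0 < 1 + dcsM * Real.log ((T : ℝ) + 1) := by positivity
  have hle : 1 + dcsM * Real.log ((T : ℝ) + 1) ≤ 1 + dcsM * harm T := by
    have := mul_le_mul_of_nonneg_left (log_succ_le_harm T) hm.le; linarith
  exact (HexIrrTailBound_holds T hT).trans (one_div_le_one_div_of_le hpos hle)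

/-! ### (b) The truncated-mean bound (Chebyshev) -/

/-- `u` is non-increasing: `u_0 = 1 ≥ B_1 ≥ B_2 ≥ ⋯` (Krachun–Panagiotis Lemma 2.3 and `B_1 ≤ 1`).
[cite: KrachunPanagiotis2026, Lemma 2.3] -/
private theorem rU_antitone : Antitone rU := by
  refine antitone_nat_of_succ_le fun n => ?_
  rcases Nat.eq_zero_or_pos n with rfl | hn
  · rw [Nat.zero_add, rU_of_ne one_ne_zero, rU_zero]; exact bridge_le_one le_rfl
  · rw [rU_of_ne hn.ne', rU_of_ne (Nat.succ_ne_zero n)]; exact stripBlim_succ_le hn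

/-- **(b), product form: `T + 1 ≤ (1 + U_T) · Σ_{j ≤ T} r_j`** — CHEBYSHEV's sum inequality applied to the
last-renewal identity: `u_n` is non-increasing and `r_{T−n}` non-decreasing in `n`, so
`1 = Σ_{n ≤ T} u_n r_{T−n} ≤ (T+1)⁻¹ (Σ_{n ≤ T} u_n)(Σ_{j ≤ T} r_j)`.
[cite: MadrasSlade1993, Appendix B, eq. (B.5); KrachunPanagiotis2026, Lemma 2.3] -/
theorem succ_le_one_add_bridgeMass_mul_sum_irrTail (T : ℕ) :
    (T : ℝ) + 1 ≤ (1 + bridgeMass T) * ∑ j ∈ range (T + 1), irrTail j := by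
  -- `g n := r_{T-n}` is monotone in `n`
  have hg : Monotone fun n : ℕ => irrTail (T - n) := fun a b hab => irrTail_antitone (Nat.sub_le_sub_left hab T)
  have hav : AntivaryOn rU (fun n : ℕ => irrTail (T - n)) (range (T + 1) : Finset ℕ) :=
    (rU_antitone.antivary hg).antivaryOn _
  have hcheb := hav.card_mul_sum_le_sum_mul_sum
  rw [card_range, sum_rU_mul_irrTail_eq_one, mul_one, sum_rU_eq] at hcheb
  have hrefl : ∑ n ∈ range (T + 1), irrTail (T - n) = ∑ j ∈ range (T + 1), irrTail j := by
    rw [← sum_range_reflect (fun j => irrTail j) (T + 1)]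
    exact sum_congr rfl fun n _ => congrArg irrTail (by omega)
  rw [hrefl] at hcheb
  exact_mod_cast hcheb

/-- **(b) The explicit truncated mean of the critical irreducible-bridge width law on the hexagonal lattice**
(quantitative null recurrence): `E[min(width, T+1)] = Σ_{j ≤ T} r_j ≥ (T+1)/(1 + U_T)` for every `T ≥ 1`,
`U_T = Σ_{t ≤ T} B_t(x_c)` (the lane's explicit form; ingredients: the conservation law (B.5), Chebyshev's sum
inequality, `B_T` non-increasing). [cite: MadrasSlade1993, Appendix B, eq. (B.5); KrachunPanagiotis2026, Lemma 2.3; Kesten1963SAW, §4] -/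
def HexIrrMeanBound : Prop :=
  ∀ T : ℕ, 1 ≤ T → ((T : ℝ) + 1) / (1 + bridgeMass T) ≤ ∑ j ∈ range (T + 1), irrTail j

/-- **(b) holds.** [cite: MadrasSlade1993, Appendix B, eq. (B.5); KrachunPanagiotis2026, Lemma 2.3; Kesten1963SAW, §4] -/
theorem HexIrrMeanBound_holds : HexIrrMeanBound := by
  intro T _
  have hUpos : 0 < 1 + bridgeMass T := by linarith [bridgeMass_nonneg T]
  rw [div_le_iff₀ hUpos, mul_comm]
  exact succ_le_one_add_bridgeMass_mul_sum_irrTail T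

/-! ### Explicit constants: `m ≥ x_c² = 1/(2+√2)` and the numerical tail bound -/

/-- `x_c² ≤ B_1(x_c)` (the two-vertex bridge of the width-one strip). [cite: DuminilCopinSmirnov2012, §3 ("B_1 > 0")] -/
theorem sq_hexCriticalFugacity_le_stripBlim_one : hexCriticalFugacity ^ 2 ≤ stripBlim 1 :=
  (sq_le_stripB_one 0 hexCriticalFugacity_pos_lt_one.1.le).trans
    (stripB_le_lim DuminilCopinSmirnov2012_lemma2_holds le_rfl 0)

/-- **`m ≥ x_c²`**: Duminil-Copin–Smirnov's constant `m = min(B_1, (c_α x_c⁻¹)⁻¹)` is at least `x_c² = 1/(2+√2)`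
(`B_1 ≥ x_c²`, and `(c_α x_c⁻¹)⁻¹ = x_c/c_α ≥ x_c ≥ x_c²`). [cite: DuminilCopinSmirnov2012, §3 (proof of Theorem 1)] -/
theorem sq_hexCriticalFugacity_le_dcsM : hexCriticalFugacity ^ 2 ≤ dcsM := by
  refine le_min sq_hexCriticalFugacity_le_stripBlim_one ?_
  have hx := hexCriticalFugacity_pos_lt_one
  have hc : 0 < Real.cos (3 * Real.pi / 8) := cos_three_pi_div_eight_pos
  have hc1 : Real.cos (3 * Real.pi / 8) ≤ 1 := Real.cos_le_one _
  rw [mul_inv, inv_inv]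
  have h1 : (1 : ℝ) ≤ (Real.cos (3 * Real.pi / 8))⁻¹ := one_le_inv_iff₀.2 ⟨hc, hc1⟩
  calc hexCriticalFugacity ^ 2 = hexCriticalFugacity * hexCriticalFugacity := sq _
    _ ≤ 1 * hexCriticalFugacity := mul_le_mul_of_nonneg_right hx.2.le hx.1.le
    _ ≤ (Real.cos (3 * Real.pi / 8))⁻¹ * hexCriticalFugacity := mul_le_mul_of_nonneg_right h1 hx.1.le

/-- `x_c² = 1/(2+√2)`. [cite: DuminilCopinSmirnov2012, Theorem 1] -/
theorem hexCriticalFugacity_sq_eq : hexCriticalFugacity ^ 2 = 1 / (2 + Real.sqrt 2) := by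
  have h := hexCriticalFugacity_sq
  have hpos : (0 : ℝ) < 2 + Real.sqrt 2 := by positivity
  rw [eq_div_iff hpos.ne']
  exact h

/-- **(a) with a numerical constant**: `P(width > T) = r_T ≤ 1/(1 + H_T/(2+√2))` for every `T ≥ 1`
(`1/(2+√2) = 0.2928…`; the exact `B_1(x_c) = 2√2 − 2` would give `0.8284…` in place of `1/(2+√2)`).
[cite: DuminilCopinSmirnov2012, §3; Kesten1963SAW, §4; MadrasSlade1993, Appendix B, eq. (B.5)] -/
theorem irrTail_le_inv_harm_numeric (T : ℕ) (hT : 1 ≤ T) :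
    irrTail T ≤ 1 / (1 + harm T / (2 + Real.sqrt 2)) := by
  have hH : 0 ≤ harm T := sum_nonneg fun t _ => by positivity
  have hpos : (0 : ℝ) < 2 + Real.sqrt 2 := by positivity
  have hden : 0 < 1 + harm T / (2 + Real.sqrt 2) := by positivity
  have hle : 1 + harm T / (2 + Real.sqrt 2) ≤ 1 + dcsM * harm T := by
    have h1 : harm T / (2 + Real.sqrt 2) = hexCriticalFugacity ^ 2 * harm T := by
      rw [hexCriticalFugacity_sq_eq, div_eq_mul_one_div, mul_comm]
    rw [h1]
    have := mul_le_mul_of_nonneg_right sq_hexCriticalFugacity_le_dcsM hH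
    linarith
  exact (HexIrrTailBound_holds T hT).trans (one_div_le_one_div_of_le hden hle)

/-- **(a), logarithmic form with a numerical constant**: `P(width > T) ≤ 1/(1 + log(T+1)/(2+√2))`, `T ≥ 1`.
[cite: DuminilCopinSmirnov2012, §3; Kesten1963SAW, §4] -/
theorem irrTail_le_inv_log_numeric (T : ℕ) (hT : 1 ≤ T) :
    irrTail T ≤ 1 / (1 + Real.log ((T : ℝ) + 1) / (2 + Real.sqrt 2)) := by
  have hpos : (0 : ℝ) < 2 + Real.sqrt 2 := by positivity
  have hlog : 0 ≤ Real.log ((T : ℝ) + 1) := Real.log_nonneg (by norm_cast; omega)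
  have hden : 0 < 1 + Real.log ((T : ℝ) + 1) / (2 + Real.sqrt 2) := by positivity
  have hle : 1 + Real.log ((T : ℝ) + 1) / (2 + Real.sqrt 2) ≤ 1 + harm T / (2 + Real.sqrt 2) := by
    have := div_le_div_of_nonneg_right (log_succ_le_harm T) hpos.le
    linarith
  exact (irrTail_le_inv_harm_numeric T hT).trans (one_div_le_one_div_of_le hden hle)

end HV

end Literature.Probability.RandomPlanarGeometry.SAW
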